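import Mathlib.Analysis.Calculus.BumpFunction.Convolution
import Mathlib.Analysis.Calculus.BumpFunction.FiniteDimension
import Mathlib.Analysis.Calculus.ContDiff.Convolution
import Mathlib.Analysis.Calculus.LineDeriv.IntegrationByParts
import Literature.Analysis.PDE.HeatLiouville
import HarnessLib

/-!
# The Liouville theorem for `C^{2,1}` solutions of the heat equation with Hölder derivatives

Topic `Literature/Analysis/PDE` (continuation of `HeatLiouville.lean`).  The rigidity step of
L. Simon's blow-up proof of the parabolic Schauder estimates: an entire classical solution
`u : ℝ × E → F` of `∂ₜ u = Δ u` (continuous `u`, `uₜ`, `Du`, `D²u`, the derivatives taken as line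
derivatives in the directions `(1, 0)` and `(0, e)`) whose time derivative and spatial Hessian
are globally Hölder continuous for the parabolic distance with an exponent `α < 1` has CONSTANT
`uₜ` and `D²u` (`hessian_const_of_heat_of_holder`).  Such `u` are in general not `C²` in
space-time, so `heat_liouville` is applied to mollifications: for a smooth compactly supported
kernel `ρ`,

* `fderiv_convolution_apply_eq_convolution_lineDeriv` — `D(ρ ⋆ w) a = ρ ⋆ ∂ₐw` for continuous `w`
  with a continuous line-derivative field `∂ₐw` (differentiate the kernel, Mathlib
  `HasCompactSupport.hasFDerivAt_convolution_left`, then integrate by parts in the direction `a`,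
  Mathlib `integral_bilinear_hasLineDerivAt_right_eq_neg_left_of_integrable`); stated on any
  finite-dimensional space with an additive Haar measure;
* `norm_convolution_sub_convolution_le` — a probability kernel preserves translation-invariant
  moduli of continuity;
* `heat_convolution` — `ρ ⋆ u` is smooth, `∂ₜ(ρ ⋆ u) = ρ ⋆ uₜ`, `∂ₑ∂ₑ'(ρ ⋆ u) = ρ ⋆ D²u(e, e')`, and
  `ρ ⋆ u` solves the heat equation (frame operators `dt`, `dx`, `lap` of
  `FluidPDE/CarlemanCalculus.lean`, with the commutation rules `dx_dx_comm`, `dt_dx_comm`,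
  `dx_lap_comm`, `dt_lap_comm`, `heat_dx`, `heat_dt` for smooth fields);
* `eq_of_heat_of_norm_sub_le` — a smooth entire caloric `W` with
  `‖W z - W 0‖ ≤ B (‖x‖ + √|t|)^α`, `α < 1`, is constant (`heat_liouville` on `t < T`, `T → ∞`);
* `hessian_const_of_heat_of_holder` — the theorem (shrink the kernel:
  `ContDiffBump.convolution_tendsto_right_of_continuous`).

Everything is PROVED; no definitions, no named facts.

## References

* L. Simon, *Schauder estimates by scaling*, Calc. Var. PDE 5 (1997) 391–407 (the method served;
  not held — statement and proof here are self-contained).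
* [Evans2010] L. C. Evans, *Partial Differential Equations*, 2nd ed., AMS 2010, §2.3.3 and App. C.4
  (mollifiers).
-/

noncomputable section

open MeasureTheory Set Function Filter Metric Real ContinuousLinearMap
open scoped Topology Convolution ContDiff

namespace Literature.Analysis.PDE

/-! ### Differentiating a mollification through line derivatives of the rough factor -/

section Mollify

variable {G : Type*} [NormedAddCommGroup G] [NormedSpace ℝ G] [FiniteDimensional ℝ G]
  [MeasurableSpace G] [BorelSpace G] (μ : Measure G) [μ.IsAddHaarMeasure]
variable {F : Type*} [NormedAddCommGroup F] [NormedSpace ℝ F]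

/-- **Mollification commutes with line derivatives**: if `ρ ∈ C¹_c(G)`, `w` is continuous with a
continuous line-derivative field `w'` in the direction `a` (`∂_a w = w'` everywhere), then
`D(ρ ⋆ w)(x) a = (ρ ⋆ w')(x)` (differentiate the smooth factor, then integrate by parts in the
direction `a`). [folklore] -/
theorem fderiv_convolution_apply_eq_convolution_lineDeriv {ρ : G → ℝ} (hρ : ContDiff ℝ 1 ρ)
    (hρc : HasCompactSupport ρ) {w w' : G → F} (hw : Continuous w) (hw' : Continuous w')
    {a : G} (hline : ∀ y, HasLineDerivAt ℝ w (w' y) y a) (x : G) :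
    fderiv ℝ (ρ ⋆[lsmul ℝ ℝ, μ] w) x a = (ρ ⋆[lsmul ℝ ℝ, μ] w') x := by
  -- `D(ρ ⋆ w)(x) a = ∫ Dρ(x - y) a • w y`
  have hD := (hρc.hasFDerivAt_convolution_left (lsmul ℝ ℝ) hρ (hw.locallyIntegrable (μ := μ))
    x).fderiv
  have hex : ConvolutionExistsAt (fderiv ℝ ρ) w x ((lsmul ℝ ℝ).precompL G) μ :=
    (hρc.fderiv (𝕜 := ℝ)).convolutionExists_left _ (hρ.continuous_fderiv one_ne_zero)
      hw.locallyIntegrable x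
  have h1 : fderiv ℝ (ρ ⋆[lsmul ℝ ℝ, μ] w) x a = ∫ y, (fderiv ℝ ρ (x - y) a) • w y ∂μ := by
    rw [hD, convolution_eq_swap, ContinuousLinearMap.integral_apply hex.integrable_swap]
    simp [precompL_apply, lsmul_apply]
  have h2 : (ρ ⋆[lsmul ℝ ℝ, μ] w') x = ∫ y, ρ (x - y) • w' y ∂μ := by
    rw [convolution_eq_swap]; simp [lsmul_apply]
  rw [h1, h2]
  -- integration by parts in the direction `a`
  set f : G → ℝ := fun y => ρ (x - y) with hf
  set f' : G → ℝ := fun y => -(fderiv ℝ ρ (x - y) a) with hf'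
  have hH : (fun y : G => x - y) = (Homeomorph.neg G).trans (Homeomorph.addLeft x) := by
    funext y; simp [sub_eq_add_neg]
  have hfc : HasCompactSupport f := by
    have h := hρc.comp_homeomorph ((Homeomorph.neg G).trans (Homeomorph.addLeft x))
    rwa [← hH] at h
  have hFc : HasCompactSupport fun y => fderiv ℝ ρ (x - y) := by
    have h := (hρc.fderiv (𝕜 := ℝ)).comp_homeomorph
      ((Homeomorph.neg G).trans (Homeomorph.addLeft x))
    rwa [← hH] at h
  have hf'c : HasCompactSupport f' :=
    hFc.comp_left (g := fun L : G →L[ℝ] ℝ => -(L a)) (by simp)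
  have hfd : ∀ y, HasFDerivAt f ((fderiv ℝ ρ (x - y)).comp (-ContinuousLinearMap.id ℝ G)) y :=
    fun y => ((hρ.differentiable one_ne_zero) _).hasFDerivAt.comp y
      ((hasFDerivAt_id y).const_sub x)
  have hfcont : Continuous f := hρ.continuous.comp (continuous_const.sub continuous_id)
  have hf'cont : Continuous f' :=
    (((hρ.continuous_fderiv one_ne_zero).comp (continuous_const.sub continuous_id)).clm_apply
      continuous_const).neg
  have hIBP := integral_bilinear_hasLineDerivAt_right_eq_neg_left_of_integrable
    (μ := μ) (B := (lsmul ℝ ℝ : ℝ →L[ℝ] F →L[ℝ] F))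
    (f := f) (f' := f') (g := w) (g' := w') (v := a) ?_ ?_ ?_ ?_ ?_
  · simp only [lsmul_apply, hf, hf', neg_smul, integral_neg, neg_neg] at hIBP
    exact hIBP.symm
  · exact (hf'cont.smul hw).integrable_of_hasCompactSupport hf'c.smul_right
  · exact (hfcont.smul hw').integrable_of_hasCompactSupport hfc.smul_right
  · exact (hfcont.smul hw).integrable_of_hasCompactSupport hfc.smul_right
  · intro y _
    have h := (hfd y).hasLineDerivAt a
    simpa [hf'] using h
  · exact fun y _ => hline y

omit [NormedSpace ℝ G] [FiniteDimensional ℝ G] in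
/-- Mollification is additive over finite sums of continuous functions. [folklore] -/
theorem convolution_finset_sum {ρ : G → ℝ} (hρ : Continuous ρ) (hρc : HasCompactSupport ρ)
    {ι : Type*} (s : Finset ι) {g : ι → G → F} (hg : ∀ i, Continuous (g i)) (x : G) :
    (ρ ⋆[lsmul ℝ ℝ, μ] fun y => ∑ i ∈ s, g i y) x = ∑ i ∈ s, (ρ ⋆[lsmul ℝ ℝ, μ] g i) x := by
  simp only [convolution_lsmul, Finset.smul_sum]
  rw [integral_finsetSum]
  intro i _
  exact (hρ.smul ((hg i).comp (continuous_const.sub continuous_id))).integrable_of_hasCompactSupport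
    hρc.smul_right

omit [NormedSpace ℝ G] [FiniteDimensional ℝ G] in
/-- **Mollification with a probability kernel preserves a translation-invariant modulus of
continuity**: if `ρ ≥ 0`, `∫ ρ = 1` and `‖g z - g w‖ ≤ ω(z - w)`, then
`‖(ρ ⋆ g) z - (ρ ⋆ g) w‖ ≤ ω(z - w)`. [folklore] -/
theorem norm_convolution_sub_convolution_le {ρ : G → ℝ} (hρ : Continuous ρ)
    (hρc : HasCompactSupport ρ) (hρ0 : ∀ t, 0 ≤ ρ t) (hρ1 : ∫ t, ρ t ∂μ = 1) {g : G → F}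
    (hg : Continuous g) {md : G → ℝ} (hmd : ∀ z w, ‖g z - g w‖ ≤ md (z - w)) (z w : G) :
    ‖(ρ ⋆[lsmul ℝ ℝ, μ] g) z - (ρ ⋆[lsmul ℝ ℝ, μ] g) w‖ ≤ md (z - w) := by
  have hint : ∀ x : G, Integrable (fun t => ρ t • g (x - t)) μ := fun x =>
    (hρ.smul (hg.comp (continuous_const.sub continuous_id))).integrable_of_hasCompactSupport
      hρc.smul_right
  rw [convolution_lsmul, convolution_lsmul, ← integral_sub (hint z) (hint w)]
  calc ‖∫ t, (ρ t • g (z - t) - ρ t • g (w - t)) ∂μ‖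
      ≤ ∫ t, ‖ρ t • g (z - t) - ρ t • g (w - t)‖ ∂μ := norm_integral_le_integral_norm _
    _ ≤ ∫ t, ρ t * md (z - w) ∂μ := by
        refine integral_mono_of_nonneg (Eventually.of_forall fun t => norm_nonneg _)
          ((hρ.mul continuous_const).integrable_of_hasCompactSupport hρc.mul_right)
          (Eventually.of_forall fun t => ?_)
        simp only
        rw [← smul_sub, norm_smul, Real.norm_eq_abs, abs_of_nonneg (hρ0 t)]
        refine mul_le_mul_of_nonneg_left ?_ (hρ0 t)
        have h := hmd (z - t) (w - t)
        rwa [sub_sub_sub_cancel_right] at h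
    _ = md (z - w) := by rw [integral_mul_const, hρ1, one_mul]

end Mollify

/-! ### Commuting the frame operators with each other for smooth fields -/

section Carleman

open Literature.Analysis.FluidPDE Literature.Analysis.FluidPDE.Carleman

variable {E : Type*} [NormedAddCommGroup E] [InnerProductSpace ℝ E]
variable {F : Type*} [NormedAddCommGroup F] [NormedSpace ℝ F]
variable {V : ℝ × E → F}

/-- `∂ₑ∂ₑ' V = ∂ₑ'∂ₑ V` (Schwarz) for smooth `V`, as functions. [folklore] -/
theorem dx_dx_comm (hV : ContDiff ℝ (⊤ : ℕ∞) V) (e e' : E) : dx e (dx e' V) = dx e' (dx e V) :=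
  funext fun z => fderiv_apply_comm hV z _ _

/-- `∂ₜ∂ₑ V = ∂ₑ∂ₜ V` for smooth `V`, as functions. [folklore] -/
theorem dt_dx_comm (hV : ContDiff ℝ (⊤ : ℕ∞) V) (e : E) : dt (dx e V) = dx e (dt V) :=
  funext fun z => (dx_dt_comm hV e z).symm

/-- `∂_w (Σᵢ Vᵢ) = Σᵢ ∂_w Vᵢ` for differentiable fields. [folklore] -/
theorem fderiv_finset_sum_apply {ι : Type*} (s : Finset ι) {V : ι → ℝ × E → F}
    (hV : ∀ i, Differentiable ℝ (V i)) (z w : ℝ × E) :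
    fderiv ℝ (fun y => ∑ i ∈ s, V i y) z w = ∑ i ∈ s, fderiv ℝ (V i) z w := by
  rw [fderiv_fun_sum fun i _ => (hV i) z]
  simp only [FunLike.coe_sum, Finset.sum_apply]

variable [FiniteDimensional ℝ E]

/-- `∂ₑ Δ V = Δ ∂ₑ V` for smooth `V`. [folklore] -/
theorem dx_lap_comm (hV : ContDiff ℝ (⊤ : ℕ∞) V) (e : E) : dx e (lap V) = lap (dx e V) := by
  funext z
  have h1 : lap V = fun y => ∑ i, dx (stdOrthonormalBasis ℝ E i)
      (dx (stdOrthonormalBasis ℝ E i) V) y := rfl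
  rw [dx_apply, h1, fderiv_finset_sum_apply _
    (fun i => ((contDiff_dx (contDiff_dx hV _) _).differentiable (by simp)))]
  show ∑ i, dx e (dx (stdOrthonormalBasis ℝ E i) (dx (stdOrthonormalBasis ℝ E i) V)) z = _
  rw [lap]
  refine Finset.sum_congr rfl fun i _ => ?_
  rw [dx_dx_comm (contDiff_dx hV _) e, dx_dx_comm hV e]

/-- `∂ₜ Δ V = Δ ∂ₜ V` for smooth `V`. [folklore] -/
theorem dt_lap_comm (hV : ContDiff ℝ (⊤ : ℕ∞) V) : dt (lap V) = lap (dt V) := by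
  funext z
  have h1 : lap V = fun y => ∑ i, dx (stdOrthonormalBasis ℝ E i)
      (dx (stdOrthonormalBasis ℝ E i) V) y := rfl
  rw [dt_apply, h1, fderiv_finset_sum_apply _
    (fun i => ((contDiff_dx (contDiff_dx hV _) _).differentiable (by simp)))]
  show ∑ i, dt (dx (stdOrthonormalBasis ℝ E i) (dx (stdOrthonormalBasis ℝ E i) V)) z = _
  rw [lap]
  refine Finset.sum_congr rfl fun i _ => ?_
  rw [dt_dx_comm (contDiff_dx hV _), dt_dx_comm hV]

/-- Derivatives of smooth caloric fields are caloric: `∂ₜ V = Δ V` implies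
`∂ₜ (∂ₑ V) = Δ (∂ₑ V)`. [folklore] -/
theorem heat_dx (hV : ContDiff ℝ (⊤ : ℕ∞) V) (hheat : ∀ z, dt V z = lap V z) (e : E) (z : ℝ × E) :
    dt (dx e V) z = lap (dx e V) z := by
  rw [dt_dx_comm hV, ← dx_lap_comm hV, show dt V = lap V from funext hheat]

/-- `∂ₜ V = Δ V` implies `∂ₜ (∂ₜ V) = Δ (∂ₜ V)` for smooth `V`. [folklore] -/
theorem heat_dt (hV : ContDiff ℝ (⊤ : ℕ∞) V) (hheat : ∀ z, dt V z = lap V z) (z : ℝ × E) :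
    dt (dt V) z = lap (dt V) z := by
  rw [← dt_lap_comm hV, show dt V = lap V from funext hheat]

end Carleman


/-! ### The Liouville theorem for `C^{2,1}` caloric functions with Hölder second derivatives -/

section Main

open Literature.Analysis.FluidPDE Literature.Analysis.FluidPDE.Carleman

variable {E : Type*} [NormedAddCommGroup E] [InnerProductSpace ℝ E] [FiniteDimensional ℝ E]
  [MeasurableSpace E] [BorelSpace E]
variable {F : Type*} [NormedAddCommGroup F] [InnerProductSpace ℝ F] [CompleteSpace F]

/-- An arithmetic comparison of parabolic gauges: for `t < T`, `0 < T`,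
`‖x‖ + √|t| ≤ (1 + √T) (1 + ‖x‖ + √(T - t))`. [folklore] -/
theorem parabolicGauge_le {T t : ℝ} (hT : 0 < T) (ht : t < T) (r : ℝ) (hr : 0 ≤ r) :
    r + Real.sqrt |t| ≤ (1 + Real.sqrt T) * (1 + r + Real.sqrt (T - t)) := by
  have h1 : Real.sqrt |t| ≤ Real.sqrt (T - t) + Real.sqrt T := by
    rcases le_or_gt 0 t with h | h
    · rw [abs_of_nonneg h]
      have := Real.sqrt_le_sqrt ht.le
      linarith [Real.sqrt_nonneg (T - t)]
    · rw [abs_of_neg h]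
      have := Real.sqrt_le_sqrt (show -t ≤ T - t by linarith)
      linarith [Real.sqrt_nonneg T]
  have h2 : 0 ≤ Real.sqrt T := Real.sqrt_nonneg T
  have h3 : 0 ≤ Real.sqrt (T - t) := Real.sqrt_nonneg _
  nlinarith

omit [CompleteSpace F] in
/-- **Smooth caloric functions with a sublinear modulus from the origin are constant**: if `W` is
smooth on `ℝ × E` with `∂ₜ W = Δ W` and `‖W z - W 0‖ ≤ B (‖x‖ + √|t|)^α` (`z = (t, x)`,
`0 ≤ α < 1`), then `W` is constant (`heat_liouville` on the half-spaces `t < T`, `T → ∞`).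
[folklore] -/
theorem eq_of_heat_of_norm_sub_le {W : ℝ × E → F} {B α : ℝ} (hα0 : 0 ≤ α) (hα1 : α < 1)
    (hW : ContDiff ℝ (⊤ : ℕ∞) W) (hheat : ∀ z, dt W z = lap W z)
    (hmod : ∀ z : ℝ × E, ‖W z - W 0‖ ≤ B * (‖z.2‖ + Real.sqrt |z.1|) ^ α) (z : ℝ × E) :
    W z = W 0 := by
  -- `B ≥ 0` (test the modulus at `(1, 0)`)
  have hB : 0 ≤ B := by
    have h := hmod (1, 0)
    simp only [norm_zero, abs_one, Real.sqrt_one, zero_add, Real.one_rpow, mul_one] at h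
    exact (norm_nonneg _).trans h
  set T : ℝ := |z.1| + 1 with hT
  have hT0 : 0 < T := by positivity
  have hzT : z.1 < T := by have := le_abs_self z.1; linarith
  set A' : ℝ := ‖W 0‖ + B * (1 + Real.sqrt T) ^ α with hA'
  have hgrowth : ∀ w ∈ Iio T ×ˢ (univ : Set E),
      ‖W w‖ ≤ A' * (1 + ‖w.2‖ + Real.sqrt (T - w.1)) ^ α := by
    rintro w ⟨hw, -⟩
    have hw' : w.1 < T := hw
    set base : ℝ := 1 + ‖w.2‖ + Real.sqrt (T - w.1) with hbase
    have hbase1 : 1 ≤ base := by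
      have := norm_nonneg w.2; have := Real.sqrt_nonneg (T - w.1); linarith
    have hbaseα : 1 ≤ base ^ α := Real.one_le_rpow hbase1 hα0
    have h1 : (‖w.2‖ + Real.sqrt |w.1|) ^ α ≤ (1 + Real.sqrt T) ^ α * base ^ α := by
      rw [← Real.mul_rpow (by positivity) (by positivity)]
      exact Real.rpow_le_rpow (by positivity)
        (parabolicGauge_le hT0 hw' ‖w.2‖ (norm_nonneg _)) hα0
    have h2 : ‖W w‖ ≤ ‖W 0‖ + B * (‖w.2‖ + Real.sqrt |w.1|) ^ α := by
      have := hmod w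
      have := norm_le_norm_add_norm_sub' (W w) (W 0)   -- ‖W w‖ ≤ ‖W 0‖ + ‖W w - W 0‖
      linarith
    calc ‖W w‖ ≤ ‖W 0‖ + B * ((1 + Real.sqrt T) ^ α * base ^ α) := by
          nlinarith [mul_le_mul_of_nonneg_left h1 hB]
      _ ≤ ‖W 0‖ * base ^ α + B * (1 + Real.sqrt T) ^ α * base ^ α := by
          nlinarith [norm_nonneg (W 0), mul_le_mul_of_nonneg_left hbaseα (norm_nonneg (W 0))]
      _ = A' * base ^ α := by rw [hA']; ring
  have hz : z ∈ Iio T ×ˢ (univ : Set E) := ⟨hzT, mem_univ _⟩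
  have h0 : (0 : ℝ × E) ∈ Iio T ×ˢ (univ : Set E) := ⟨hT0, mem_univ _⟩
  exact heat_liouville hα0 hα1 (contDiff_two_of_top hW).contDiffOn (fun w _ => hheat w)
    hgrowth hz h0

omit [CompleteSpace F] in
/-- **Mollifying a `C^{2,1}` solution of the heat equation**: let `u : ℝ × E → F` be continuous
with continuous time derivative `uₜ` (line derivative in the direction `(1, 0)`), continuous
spatial derivative field `D` (`∂_{(0,e)} u = D e`) whose components have the continuous spatial
derivatives `D2 e e'` (`∂_{(0,e)} (D · e') = D2 · e e'`), and `uₜ = Σᵢ D2 eᵢ eᵢ`.  Then for a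
`C¹_c` kernel `ρ` the mollification `ρ ⋆ u` is smooth… precisely, for `ρ ∈ C^∞_c`:
`∂ₜ(ρ ⋆ u) = ρ ⋆ uₜ`, `∂ₑ∂ₑ'(ρ ⋆ u) = ρ ⋆ (D2 e e')`, and `ρ ⋆ u` solves the heat equation.
[folklore] -/
theorem heat_convolution {u ut : ℝ × E → F} {D : ℝ × E → E →L[ℝ] F}
    {D2 : ℝ × E → E →L[ℝ] E →L[ℝ] F}
    (hu : Continuous u) (hut : Continuous ut) (hD : Continuous D) (hD2 : Continuous D2)
    (ht : ∀ z, HasLineDerivAt ℝ u (ut z) z (1, 0))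
    (hx : ∀ z e, HasLineDerivAt ℝ u (D z e) z (0, e))
    (hxx : ∀ z e e', HasLineDerivAt ℝ (fun y => D y e') (D2 z e e') z (0, e))
    (hheat : ∀ z, ut z = ∑ i, D2 z (stdOrthonormalBasis ℝ E i) (stdOrthonormalBasis ℝ E i))
    {ρ : ℝ × E → ℝ} (hρ : ContDiff ℝ (⊤ : ℕ∞) ρ) (hρc : HasCompactSupport ρ)
    (μ : Measure (ℝ × E)) [μ.IsAddHaarMeasure] :
    ContDiff ℝ (⊤ : ℕ∞) (ρ ⋆[lsmul ℝ ℝ, μ] u) ∧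
    (dt (ρ ⋆[lsmul ℝ ℝ, μ] u) = ρ ⋆[lsmul ℝ ℝ, μ] ut) ∧
    (∀ e e', dx e (dx e' (ρ ⋆[lsmul ℝ ℝ, μ] u)) =
      ρ ⋆[lsmul ℝ ℝ, μ] fun y => D2 y e e') ∧
    (∀ z, dt (ρ ⋆[lsmul ℝ ℝ, μ] u) z = lap (ρ ⋆[lsmul ℝ ℝ, μ] u) z) := by
  have hρ1 : ContDiff ℝ 1 ρ := hρ.of_le (by exact_mod_cast le_top)
  have hsmooth : ContDiff ℝ (⊤ : ℕ∞) (ρ ⋆[lsmul ℝ ℝ, μ] u) :=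
    hρc.contDiff_convolution_left _ hρ hu.locallyIntegrable
  have hdt : dt (ρ ⋆[lsmul ℝ ℝ, μ] u) = ρ ⋆[lsmul ℝ ℝ, μ] ut := by
    funext z
    rw [dt_apply]
    exact fderiv_convolution_apply_eq_convolution_lineDeriv μ hρ1 hρc hu hut ht z
  have hdx : ∀ e', dx e' (ρ ⋆[lsmul ℝ ℝ, μ] u) = ρ ⋆[lsmul ℝ ℝ, μ] fun y => D y e' := by
    intro e'
    funext z
    rw [dx_apply]
    exact fderiv_convolution_apply_eq_convolution_lineDeriv μ hρ1 hρc hu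
      (hD.clm_apply continuous_const) (fun y => hx y e') z
  have hdxx : ∀ e e', dx e (dx e' (ρ ⋆[lsmul ℝ ℝ, μ] u)) =
      ρ ⋆[lsmul ℝ ℝ, μ] fun y => D2 y e e' := by
    intro e e'
    funext z
    rw [hdx e', dx_apply]
    exact fderiv_convolution_apply_eq_convolution_lineDeriv μ hρ1 hρc
      (hD.clm_apply continuous_const) ((hD2.clm_apply continuous_const).clm_apply continuous_const)
      (fun y => hxx y e e') z
  refine ⟨hsmooth, hdt, hdxx, fun z => ?_⟩
  -- the heat equation for the mollification
  have hlap : lap (ρ ⋆[lsmul ℝ ℝ, μ] u) z =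
      (ρ ⋆[lsmul ℝ ℝ, μ] fun y => ∑ i, D2 y (stdOrthonormalBasis ℝ E i)
        (stdOrthonormalBasis ℝ E i)) z := by
    rw [convolution_finset_sum μ hρ.continuous hρc _
      (fun i => (hD2.clm_apply continuous_const).clm_apply continuous_const)]
    show ∑ i, dx (stdOrthonormalBasis ℝ E i) (dx (stdOrthonormalBasis ℝ E i)
      (ρ ⋆[lsmul ℝ ℝ, μ] u)) z = _
    exact Finset.sum_congr rfl fun i _ => by rw [hdxx]
  have hfun : (fun y => ∑ i, D2 y (stdOrthonormalBasis ℝ E i) (stdOrthonormalBasis ℝ E i)) = ut :=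
    funext fun y => (hheat y).symm
  rw [hlap, hfun, hdt]

/-- **The Liouville theorem for `C^{2,1}` solutions of the heat equation with Hölder second
derivatives** (the rigidity step of L. Simon's blow-up proof of the parabolic Schauder
estimates).  Let `u : ℝ × E → F` be an entire classical solution of `∂ₜ u = Δ u` in the sense of
`heat_convolution` (continuous `u, uₜ, D u, D² u`, derivatives as line derivatives), whose time
derivative and spatial Hessian are globally Hölder continuous for the parabolic distance:
`‖uₜ(z) - uₜ(w)‖, ‖D²u(z) - D²u(w)‖ ≤ A (‖x - y‖ + √|t - s|)^α` with `0 ≤ α < 1`.  Then `uₜ`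
and `D²u` are constant.  (Mollify: `ρ ⋆ u` is smooth and caloric with
`∂ₑ∂ₑ'(ρ ⋆ u) = ρ ⋆ ∂ₑ∂ₑ'u` caloric and of sublinear oscillation, hence constant by
`heat_liouville`; let the kernel shrink.) [folklore] -/
theorem hessian_const_of_heat_of_holder {u ut : ℝ × E → F} {D : ℝ × E → E →L[ℝ] F}
    {D2 : ℝ × E → E →L[ℝ] E →L[ℝ] F} {A α : ℝ} (hα0 : 0 ≤ α) (hα1 : α < 1)
    (hu : Continuous u) (hut : Continuous ut) (hD : Continuous D) (hD2 : Continuous D2)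
    (ht : ∀ z, HasLineDerivAt ℝ u (ut z) z (1, 0))
    (hx : ∀ z e, HasLineDerivAt ℝ u (D z e) z (0, e))
    (hxx : ∀ z e e', HasLineDerivAt ℝ (fun y => D y e') (D2 z e e') z (0, e))
    (hheat : ∀ z, ut z = ∑ i, D2 z (stdOrthonormalBasis ℝ E i) (stdOrthonormalBasis ℝ E i))
    (hHt : ∀ z w : ℝ × E, ‖ut z - ut w‖ ≤ A * (‖z.2 - w.2‖ + Real.sqrt |z.1 - w.1|) ^ α)
    (hHxx : ∀ z w : ℝ × E, ‖D2 z - D2 w‖ ≤ A * (‖z.2 - w.2‖ + Real.sqrt |z.1 - w.1|) ^ α) :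
    (∀ z, D2 z = D2 0) ∧ (∀ z, ut z = ut 0) := by
  -- Lebesgue measure on `ℝ × E` is an additive Haar measure
  haveI hHaar : (volume : Measure (ℝ × E)).IsAddHaarMeasure :=
    Measure.prod.instIsAddHaarMeasure _ _
  -- a shrinking sequence of normalised bump kernels on `ℝ × E`
  set φ : ℕ → ContDiffBump (0 : ℝ × E) := fun n =>
    ⟨1 / ((n : ℝ) + 2), 1 / ((n : ℝ) + 1), by positivity,
      one_div_lt_one_div_of_lt (by positivity) (by linarith)⟩ with hφ
  have hφout : Tendsto (fun n => (φ n).rOut) atTop (𝓝 0) :=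
    tendsto_one_div_add_atTop_nhds_zero_nat
  have hρs : ∀ n, ContDiff ℝ (⊤ : ℕ∞) ((φ n).normed volume) := fun n => (φ n).contDiff_normed
  have hρc : ∀ n, HasCompactSupport ((φ n).normed volume) := fun n =>
    (φ n).hasCompactSupport_normed
  have hρ0 : ∀ n t, 0 ≤ (φ n).normed volume t := fun n t => (φ n).nonneg_normed t
  have hρ1 : ∀ n, ∫ t, (φ n).normed volume t = 1 := fun n => (φ n).integral_normed
  -- the mollifications solve the heat equation, with the expected derivatives
  have hM := fun n => heat_convolution hu hut hD hD2 ht hx hxx hheat (hρs n) (hρc n) volume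
  refine ⟨fun z => ?_, fun z => ?_⟩
  · -- the Hessian
    refine ContinuousLinearMap.ext fun e => ContinuousLinearMap.ext fun e' => ?_
    set g : ℝ × E → F := fun y => D2 y e e' with hg
    have hgc : Continuous g := (hD2.clm_apply continuous_const).clm_apply continuous_const
    have hgmod : ∀ z w : ℝ × E, ‖g z - g w‖ ≤
        (A * ‖e‖ * ‖e'‖) * (‖(z - w).2‖ + Real.sqrt |(z - w).1|) ^ α := by
      intro z w
      have hsub : g z - g w = (D2 z - D2 w) e e' := rfl
      rw [hsub, Prod.snd_sub, Prod.fst_sub]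
      calc ‖(D2 z - D2 w) e e'‖ ≤ ‖D2 z - D2 w‖ * ‖e‖ * ‖e'‖ := (D2 z - D2 w).le_opNorm₂ e e'
        _ ≤ A * (‖z.2 - w.2‖ + Real.sqrt |z.1 - w.1|) ^ α * ‖e‖ * ‖e'‖ := by
            gcongr; exact hHxx z w
        _ = (A * ‖e‖ * ‖e'‖) * (‖z.2 - w.2‖ + Real.sqrt |z.1 - w.1|) ^ α := by ring
    -- each mollification of `g` is constant
    have hconst : ∀ n, ((φ n).normed volume ⋆[lsmul ℝ ℝ, volume] g) z =
        ((φ n).normed volume ⋆[lsmul ℝ ℝ, volume] g) 0 := by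
      intro n
      obtain ⟨hsm, -, hdxx, hheatM⟩ := hM n
      have hWg : dx e (dx e' ((φ n).normed volume ⋆[lsmul ℝ ℝ, volume] u)) =
          (φ n).normed volume ⋆[lsmul ℝ ℝ, volume] g := hdxx e e'
      have hWs : ContDiff ℝ (⊤ : ℕ∞)
          (dx e (dx e' ((φ n).normed volume ⋆[lsmul ℝ ℝ, volume] u))) :=
        contDiff_dx (contDiff_dx hsm _) _
      have hWheat : ∀ w, dt (dx e (dx e' ((φ n).normed volume ⋆[lsmul ℝ ℝ, volume] u))) w =
          lap (dx e (dx e' ((φ n).normed volume ⋆[lsmul ℝ ℝ, volume] u))) w := by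
        intro w
        have h1 := heat_dx hsm hheatM e'
        exact heat_dx (contDiff_dx hsm _) h1 e w
      have hWmod : ∀ w : ℝ × E,
          ‖dx e (dx e' ((φ n).normed volume ⋆[lsmul ℝ ℝ, volume] u)) w -
            dx e (dx e' ((φ n).normed volume ⋆[lsmul ℝ ℝ, volume] u)) 0‖ ≤
          (A * ‖e‖ * ‖e'‖) * (‖w.2‖ + Real.sqrt |w.1|) ^ α := by
        intro w
        rw [hWg]
        have h := norm_convolution_sub_convolution_le volume (hρs n).continuous (hρc n) (hρ0 n)
          (hρ1 n) hgc (md := fun v => A * ‖e‖ * ‖e'‖ * (‖v.2‖ + Real.sqrt |v.1|) ^ α) hgmod w 0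
        simpa using h
      have h := eq_of_heat_of_norm_sub_le hα0 hα1 hWs hWheat hWmod z
      rwa [hWg] at h
    -- pass to the limit `n → ∞`
    have h1 := ContDiffBump.convolution_tendsto_right_of_continuous (μ := volume) hφout hgc z
    have h2 := ContDiffBump.convolution_tendsto_right_of_continuous (μ := volume) hφout hgc 0
    have h3 : (fun n => ((φ n).normed volume ⋆[lsmul ℝ ℝ, volume] g) z) =
        fun n => ((φ n).normed volume ⋆[lsmul ℝ ℝ, volume] g) 0 := funext hconst
    rw [h3] at h1
    exact tendsto_nhds_unique h1 h2
  · -- the time derivative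
    have hgmod : ∀ z w : ℝ × E, ‖ut z - ut w‖ ≤
        A * (‖(z - w).2‖ + Real.sqrt |(z - w).1|) ^ α := fun z w => by
      simpa only [Prod.snd_sub, Prod.fst_sub] using hHt z w
    have hconst : ∀ n, ((φ n).normed volume ⋆[lsmul ℝ ℝ, volume] ut) z =
        ((φ n).normed volume ⋆[lsmul ℝ ℝ, volume] ut) 0 := by
      intro n
      obtain ⟨hsm, hdt, -, hheatM⟩ := hM n
      have hWs : ContDiff ℝ (⊤ : ℕ∞) (dt ((φ n).normed volume ⋆[lsmul ℝ ℝ, volume] u)) :=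
        contDiff_dt hsm
      have hWheat : ∀ w, dt (dt ((φ n).normed volume ⋆[lsmul ℝ ℝ, volume] u)) w =
          lap (dt ((φ n).normed volume ⋆[lsmul ℝ ℝ, volume] u)) w :=
        fun w => heat_dt hsm hheatM w
      have hWmod : ∀ w : ℝ × E,
          ‖dt ((φ n).normed volume ⋆[lsmul ℝ ℝ, volume] u) w -
            dt ((φ n).normed volume ⋆[lsmul ℝ ℝ, volume] u) 0‖ ≤
          A * (‖w.2‖ + Real.sqrt |w.1|) ^ α := by
        intro w
        rw [hdt]
        have h := norm_convolution_sub_convolution_le volume (hρs n).continuous (hρc n) (hρ0 n)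
          (hρ1 n) hut (md := fun v => A * (‖v.2‖ + Real.sqrt |v.1|) ^ α) hgmod w 0
        simpa using h
      have h := eq_of_heat_of_norm_sub_le hα0 hα1 hWs hWheat hWmod z
      rwa [hdt] at h
    have h1 := ContDiffBump.convolution_tendsto_right_of_continuous (μ := volume) hφout hut z
    have h2 := ContDiffBump.convolution_tendsto_right_of_continuous (μ := volume) hφout hut 0
    have h3 : (fun n => ((φ n).normed volume ⋆[lsmul ℝ ℝ, volume] ut) z) =
        fun n => ((φ n).normed volume ⋆[lsmul ℝ ℝ, volume] ut) 0 := funext hconst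
    rw [h3] at h1
    exact tendsto_nhds_unique h1 h2

end Main

end Literature.Analysis.PDE
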